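import Mathlib
import Summits.ResolutionOfSingularities.ResolutionOfSingularities.Theorems.WeightedInvariantLocalWeightedDropNCGameBWinsDefs
import Summits.ResolutionOfSingularities.ResolutionOfSingularities.Theorems.WeightedInvariantLocalWeightedDropNCResRegimePresentedAssembly

/-!
# `WeightedInvariant.LocalWeightedDrop` ENGINE, W′|₄ line — D₃ᴮ object (2b): REGIME (P) «PRESENTED» IN B-PERMISSIBLE FORM, FROM ITS PIECES

Sub-problem `ResolutionOfSingularities`, ENGINE crux `stmt-ResolutionOfSingularities-8899` (`LocalWeightedDrop`), registered stub W′|₄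
`stub_wildWideApexFourStartsWon`; res-L1-w43-plan-1 RULING 2026-08-27T21:45:42Z (D₃ᴮ lane (b)(2)); the hypothesis `hP_B` of `surfaceBoundaryNC_of_regimesB`
(…NCResPhaseAssemblyB, p579166).  [OURS · L1 W4.3 · chain w43 · res-L1-w43-lead-1 g6; def-free; the proof of `regimePresented_of_pieces` (…NCResRegimePresentedAssembly,
lead-1 g5) re-threaded over `DBWinsTo` (p575221); nothing here is a statement of any manuscript; AI-produced, gate-checked, weaker than expert review.]

* `DBWinsTo.of_measure_labels` — MEASURE FORM WITH RECORDINGS: states of the region carry auxiliary labels `ℓ` (here: the presenting label and boundary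
  `(A, N)`); the measure lives on `(state, label)`; the move at a state is the one of a measure-minimising recording.  (Replaces the rich-state trick
  `DWinsTo.of_measure` + `DWinsTo.map` of the `DWinsTo` proofs, which `DBWinsTo`'s fixed state type does not allow.)
* **`regimePresentedB_of_pieces`** — from every admissibly decorated position with `2 ≤ o`, outside the apex column, with non-empty history or letters in
  good position, the mover B-FORCES (B-permissible moves, transform successors) an admissible position of smaller head or of the same head inside the
  apex column — given the pieces of `regimePresented_of_pieces` with the two ONE-STEP pieces (P2)/(P2c) in B-form:
  `∃ Φ w, IsBPermissible δ Φ w ∧ BMoveClause (b, δ) Φ w (…)` (res-L1-w43-stub-2's `…TOT2BridgePresByStep` proofs construct exactly these — `h.1`,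
  `admissible_transform`, `δ' := δ.transform Θ w c i` — so their B-twins are re-threads).
-/

set_option linter.dupNamespace false -- mandated namespace of this single-conjunct summit

noncomputable section

namespace Summit.ResolutionOfSingularities.ResolutionOfSingularities.Theorems

namespace TameFourTupleDrop

open MvPowerSeries Literature.AlgebraicGeometry.Resolution PolyDescent

variable {k : Type} [Field k] {m : ℕ}

/-! ## Measure form with recordings -/

/-- **MEASURE FORM WITH RECORDINGS.**  `C` a set of recorded states `(τ, ℓ)`, `μ` a measure on them; if from every recording whose state is not in the
target some B-permissible move has, at every answer, its transform in the target or RECORDED in `C` with smaller measure, then every recorded state B-wins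
towards the target. -/
theorem DBWinsTo.of_measure_labels {L : Type} {Q : MvPowerSeries (Fin (m + 1)) k × Decoration k m → Prop}
    (C : Set ((MvPowerSeries (Fin (m + 1)) k × Decoration k m) × L)) (μ : (MvPowerSeries (Fin (m + 1)) k × Decoration k m) × L → Ordinal.{0})
    (hstep : ∀ σ ∈ C, ¬ Q σ.1 → ∃ (Φ : Fin (m + 1) → MvPowerSeries (Fin (m + 1)) k) (w : Fin (m + 1) → ℕ),
      IsBPermissible σ.1.2 Φ w ∧ BMoveClause σ.1 Φ w (fun τ' => Q τ' ∨ ∃ ℓ' : L, (τ', ℓ') ∈ C ∧ μ (τ', ℓ') < μ σ))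
    {σ : (MvPowerSeries (Fin (m + 1)) k × Decoration k m) × L} (hσ : σ ∈ C) : DBWinsTo Q σ.1 := by
  classical
  -- the value of a recorded state: the least measure over its recordings
  let R : Set (MvPowerSeries (Fin (m + 1)) k × Decoration k m) := {τ | ∃ ℓ : L, (τ, ℓ) ∈ C}
  let val : MvPowerSeries (Fin (m + 1)) k × Decoration k m → Ordinal.{0} := fun τ => sInf {α | ∃ ℓ : L, (τ, ℓ) ∈ C ∧ μ (τ, ℓ) = α}
  have hval : ∀ τ ∈ R, ∃ ℓ : L, (τ, ℓ) ∈ C ∧ μ (τ, ℓ) = val τ := by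
    rintro τ ⟨ℓ, hℓ⟩
    have hne : {α | ∃ ℓ : L, (τ, ℓ) ∈ C ∧ μ (τ, ℓ) = α}.Nonempty := ⟨_, ℓ, hℓ, rfl⟩
    exact csInf_mem hne
  have hval_le : ∀ τ (ℓ : L), (τ, ℓ) ∈ C → val τ ≤ μ (τ, ℓ) := fun τ ℓ h => csInf_le' ⟨ℓ, h, rfl⟩
  refine ⟨R ∪ {τ | Q τ}, fun τ => if Q τ then 0 else val τ + 1, ?_, Or.inl ⟨σ.2, by cases σ; exact hσ⟩⟩
  intro τ hτ hQ
  have hτR : τ ∈ R := hτ.resolve_right hQ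
  obtain ⟨ℓ, hℓC, hℓμ⟩ := hval τ hτR
  obtain ⟨Φ, w, hmv, hcl⟩ := hstep (τ, ℓ) hℓC hQ
  refine ⟨Φ, w, hmv, hcl.mono fun τ' hτ' => ?_⟩
  rcases hτ' with hq | ⟨ℓ', hC', hlt⟩
  · refine ⟨Or.inr hq, ?_⟩
    show (if Q τ' then (0 : Ordinal.{0}) else val τ' + 1) < (if Q τ then 0 else val τ + 1)
    rw [if_pos hq, if_neg hQ]
    exact Order.lt_add_one_iff.mpr bot_le
  · refine ⟨Or.inl ⟨ℓ', hC'⟩, ?_⟩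
    show (if Q τ' then (0 : Ordinal.{0}) else val τ' + 1) < (if Q τ then 0 else val τ + 1)
    rw [if_neg hQ]
    split_ifs
    · exact Order.lt_add_one_iff.mpr bot_le
    · rw [hℓμ] at hlt
      exact Order.lt_add_one_iff.mpr (Order.add_one_le_of_lt (lt_of_le_of_lt (hval_le τ' ℓ' hC') hlt))

/-! ## Regime (P) in B-form -/

/-- **REGIME (P), B-PERMISSIBLE FORM, FROM ITS PIECES.**  As `regimePresented_of_pieces` (same pieces `ψsel/hsel/M/hM_succ/hM_conf/hP1/hPx`), with the two
one-step pieces in B-form: (P2_B) off a conflict / (P2c_B) at a conflict, SOME B-PERMISSIBLE move has, at every answer, its TRANSFORM admissible and: of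
smaller head; or of the same head and in the apex column; or of the same head and RECORDED by a well-prepared family (resp. point-family) successor label.
Conclusion: `DBWinsTo` towards «admissible, head dropped or same head in the apex column». -/
theorem regimePresentedB_of_pieces [Infinite k]
    (ψsel : (d : ℕ) → (Fin d → MvPowerSeries (Fin 2) k) → MvPowerSeries (Fin 2) k)
    (hsel : ∀ (d : ℕ) (X : Fin d → MvPowerSeries (Fin 2) k), IsPosT d X → IsPrepRecentring d X (ψsel d X))
    (M : (d : ℕ) → (Fin d → MvPowerSeries (Fin 2) k) → Finset (Fin 2) → ℕ)
    (hM_succ : ∀ (d : ℕ) (A : Fin d → MvPowerSeries (Fin 2) k) (N : Finset (Fin 2)) (A' : Fin d → MvPowerSeries (Fin 2) k)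
      (N' : Finset (Fin 2)),
      (∃ (b : MvPowerSeries (Fin (2 + 1)) k) (δ : Decoration k 2) (Θ : Fin (2 + 1) → MvPowerSeries (Fin (2 + 1)) k),
        Admissible b δ ∧ 2 ≤ δ.o ∧ δ.c = d ∧ δ.PresBy d A N Θ) →
      InPoly d A → InPoly d A' → SuccFamilySel d (ψsel d) A N A' N' → M d A' N' ≤ M d A N)
    (hM_conf : ∀ (d : ℕ) (A : Fin d → MvPowerSeries (Fin 2) k) (N : Finset (Fin 2)) (A' : Fin d → MvPowerSeries (Fin 2) k)
      (N' : Finset (Fin 2)),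
      (∃ (b : MvPowerSeries (Fin (2 + 1)) k) (δ : Decoration k 2) (Θ : Fin (2 + 1) → MvPowerSeries (Fin (2 + 1)) k),
        Admissible b δ ∧ 2 ≤ δ.o ∧ δ.c = d ∧ δ.PresBy d A N Θ) →
      InPoly d A → InPoly d A' → NCPoly.Conflict d A N → PointFamilySel d (ψsel d) A N A' N' → M d A' N' < M d A N)
    (hP1 : ∀ (b : MvPowerSeries (Fin (2 + 1)) k) (δ : Decoration k 2), Admissible b δ → 2 ≤ δ.o → ¬ δ.HCol →
      (δ.O.Nonempty ∨ δ.GoodDir) →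
      ∃ (A : Fin δ.c → MvPowerSeries (Fin 2) k) (N : Finset (Fin 2)) (Θ : Fin (2 + 1) → MvPowerSeries (Fin (2 + 1)) k),
        δ.PresBy δ.c A N Θ ∧ InPoly δ.c A)
    (hPx : ∀ (b : MvPowerSeries (Fin (2 + 1)) k) (δ : Decoration k 2) (d : ℕ) (A : Fin d → MvPowerSeries (Fin 2) k) (N : Finset (Fin 2))
      (Θ : Fin (2 + 1) → MvPowerSeries (Fin (2 + 1)) k),
      Admissible b δ → 2 ≤ δ.o → δ.c = d → δ.PresBy d A N Θ → WellPrepared d A → ¬ InPoly d A → δ.HCol)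
    (hP2 : ∀ (b : MvPowerSeries (Fin (2 + 1)) k) (δ : Decoration k 2) (d : ℕ) (A : Fin d → MvPowerSeries (Fin 2) k) (N : Finset (Fin 2))
      (Θ : Fin (2 + 1) → MvPowerSeries (Fin (2 + 1)) k),
      Admissible b δ → 2 ≤ δ.o → δ.c = d → δ.PresBy d A N Θ → InPoly d A → ¬ NCPoly.Conflict d A N →
      ∃ (Φ : Fin (2 + 1) → MvPowerSeries (Fin (2 + 1)) k) (w : Fin (2 + 1) → ℕ), IsBPermissible δ Φ w ∧
        BMoveClause (b, δ) Φ w (fun τ' => Admissible τ'.1 τ'.2 ∧ (τ'.2.head < δ.head ∨ (τ'.2.head = δ.head ∧ (τ'.2.HCol ∨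
          ∃ (A' : Fin d → MvPowerSeries (Fin 2) k) (N' : Finset (Fin 2)) (Θ' : Fin (2 + 1) → MvPowerSeries (Fin (2 + 1)) k),
            τ'.2.PresBy d A' N' Θ' ∧ WellPrepared d A' ∧ SuccFamilySel d (ψsel d) A N A' N')))))
    (hP2c : ∀ (b : MvPowerSeries (Fin (2 + 1)) k) (δ : Decoration k 2) (d : ℕ) (A : Fin d → MvPowerSeries (Fin 2) k) (N : Finset (Fin 2))
      (Θ : Fin (2 + 1) → MvPowerSeries (Fin (2 + 1)) k),
      Admissible b δ → 2 ≤ δ.o → δ.c = d → δ.PresBy d A N Θ → InPoly d A → NCPoly.Conflict d A N →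
      ∃ (Φ : Fin (2 + 1) → MvPowerSeries (Fin (2 + 1)) k) (w : Fin (2 + 1) → ℕ), IsBPermissible δ Φ w ∧
        BMoveClause (b, δ) Φ w (fun τ' => Admissible τ'.1 τ'.2 ∧ (τ'.2.head < δ.head ∨ (τ'.2.head = δ.head ∧ (τ'.2.HCol ∨
          ∃ (A' : Fin d → MvPowerSeries (Fin 2) k) (N' : Finset (Fin 2)) (Θ' : Fin (2 + 1) → MvPowerSeries (Fin (2 + 1)) k),
            τ'.2.PresBy d A' N' Θ' ∧ WellPrepared d A' ∧ PointFamilySel d (ψsel d) A N A' N')))))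
    (b : MvPowerSeries (Fin (2 + 1)) k) (δ : Decoration k 2) (hadm : Admissible b δ) (ho : 2 ≤ δ.o) (hnc : ¬ δ.HCol)
    (hreg : δ.O.Nonempty ∨ δ.GoodDir) :
    DBWinsTo (fun τ : MvPowerSeries (Fin (2 + 1)) k × Decoration k 2 => Admissible τ.1 τ.2 ∧ (τ.2.head < δ.head ∨ (τ.2.head = δ.head ∧ τ.2.HCol)))
      (b, δ) := by
  classical
  set d : ℕ := δ.c with hd_def
  have hd : 0 < d := by rw [hd_def, Decoration.c]; omega
  obtain ⟨A₀, N₀, Θ₀, hpres₀, hin₀⟩ := hP1 b δ hadm ho hnc hreg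
  -- recordings: (decorated position, (label, boundary))
  let L : Type := (Fin d → MvPowerSeries (Fin 2) k) × Finset (Fin 2)
  let Q : MvPowerSeries (Fin (2 + 1)) k × Decoration k 2 → Prop := fun τ =>
    Admissible τ.1 τ.2 ∧ (τ.2.head < δ.head ∨ (τ.2.head = δ.head ∧ τ.2.HCol))
  let C : Set ((MvPowerSeries (Fin (2 + 1)) k × Decoration k 2) × L) := {σ | Admissible σ.1.1 σ.1.2 ∧ σ.1.2.head = δ.head ∧
    (∃ Θ : Fin (2 + 1) → MvPowerSeries (Fin (2 + 1)) k, σ.1.2.PresBy d σ.2.1 σ.2.2 Θ) ∧ InPoly d σ.2.1}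
  -- measure `Λ·M + polyhedron rank`
  let rk : (Fin d → MvPowerSeries (Fin 2) k) → Ordinal.{0} := fun A => ((wellFounded_polyRelSel (k := k) hd (hsel d)).apply A).rank
  let Λ : Ordinal.{0} := (⨆ A, rk A) + 1
  have hΛ : ∀ A, rk A < Λ := fun A => Order.lt_add_one_iff.mpr (le_ciSup (Ordinal.bddAbove_of_small (s := Set.range rk)) A)
  let μ : (MvPowerSeries (Fin (2 + 1)) k × Decoration k 2) × L → Ordinal.{0} := fun σ => Λ * (M d σ.2.1 σ.2.2 : Ordinal.{0}) + rk σ.2.1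
  have hlex : ∀ (n n' : ℕ) (A A' : Fin d → MvPowerSeries (Fin 2) k), n' < n ∨ (n' = n ∧ rk A' < rk A) →
      Λ * (n' : Ordinal.{0}) + rk A' < Λ * (n : Ordinal.{0}) + rk A := by
    rintro n n' A A' (hn | ⟨rfl, hr⟩)
    · have hn' : ((n' + 1 : ℕ) : Ordinal.{0}) ≤ (n : Ordinal.{0}) := Nat.cast_le.mpr (Nat.succ_le_of_lt hn)
      calc Λ * (n' : Ordinal.{0}) + rk A' < Λ * (n' : Ordinal.{0}) + Λ := by
            gcongr
            exact hΛ A'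
        _ = Λ * ((n' + 1 : ℕ) : Ordinal.{0}) := by rw [Nat.cast_succ, mul_add_one]
        _ ≤ Λ * (n : Ordinal.{0}) := by gcongr
        _ ≤ Λ * (n : Ordinal.{0}) + rk A := le_self_add
    · gcongr
  have hoc : ∀ δ' : Decoration k 2, δ'.head = δ.head → δ'.o = δ.o ∧ δ'.c = d := by
    intro δ' h
    rw [Decoration.head, Decoration.head, toLex_inj, Prod.ext_iff] at h
    exact ⟨h.1, h.2⟩
  have hσ₀ : (((b, δ), (A₀, N₀)) : (MvPowerSeries (Fin (2 + 1)) k × Decoration k 2) × L) ∈ C := ⟨hadm, rfl, ⟨Θ₀, hpres₀⟩, hin₀⟩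
  refine DBWinsTo.of_measure_labels (Q := Q) C μ ?_ hσ₀
  rintro ⟨⟨b₁, δ₁⟩, ⟨A₁, N₁⟩⟩ ⟨hadm₁, hhead₁, ⟨Θ₁, hpres₁⟩, hin₁⟩ -
  obtain ⟨ho₁, hc₁⟩ := hoc δ₁ hhead₁
  have ho₁' : 2 ≤ δ₁.o := by rw [ho₁]; exact ho
  have hctx : ∃ (b : MvPowerSeries (Fin (2 + 1)) k) (δ : Decoration k 2) (Θ : Fin (2 + 1) → MvPowerSeries (Fin (2 + 1)) k),
      Admissible b δ ∧ 2 ≤ δ.o ∧ δ.c = d ∧ δ.PresBy d A₁ N₁ Θ := ⟨b₁, δ₁, Θ₁, hadm₁, ho₁', hc₁, hpres₁⟩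
  -- reading a presented same-head transform: continue (recorded, measure drops) or exit (apex column)
  have hread : ∀ (τ' : MvPowerSeries (Fin (2 + 1)) k × Decoration k 2), Admissible τ'.1 τ'.2 → τ'.2.head = δ.head →
      ∀ (A' : Fin d → MvPowerSeries (Fin 2) k) (N' : Finset (Fin 2)) (Θ' : Fin (2 + 1) → MvPowerSeries (Fin (2 + 1)) k),
      τ'.2.PresBy d A' N' Θ' → WellPrepared d A' →
      (M d A' N' < M d A₁ N₁ ∨ (M d A' N' = M d A₁ N₁ ∧ rk A' < rk A₁) ∨ ¬ InPoly d A') →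
      Q τ' ∨ ∃ ℓ' : L, (τ', ℓ') ∈ C ∧ μ (τ', ℓ') < μ ((b₁, δ₁), (A₁, N₁)) := by
    intro τ' hadm' hhead' A' N' Θ' hpres' hWP' halt
    obtain ⟨ho', hc'⟩ := hoc τ'.2 hhead'
    by_cases hin' : InPoly d A'
    · rcases halt with hlt | hlt | hnin
      · exact Or.inr ⟨(A', N'), ⟨hadm', hhead', ⟨Θ', hpres'⟩, hin'⟩, hlex _ _ _ _ (Or.inl hlt)⟩
      · exact Or.inr ⟨(A', N'), ⟨hadm', hhead', ⟨Θ', hpres'⟩, hin'⟩, hlex _ _ _ _ (Or.inr hlt)⟩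
      · exact absurd hin' hnin
    · have hcol' : τ'.2.HCol := hPx τ'.1 τ'.2 d A' N' Θ' hadm' (by rw [ho']; exact ho) hc' hpres' hWP' hin'
      exact Or.inl ⟨hadm', Or.inr ⟨hhead', hcol'⟩⟩
  by_cases hconf : NCPoly.Conflict d A₁ N₁
  · -- point move at a conflict: the budget drops
    obtain ⟨Φ, w, hmv, hcl⟩ := hP2c b₁ δ₁ d A₁ N₁ Θ₁ hadm₁ ho₁' hc₁ hpres₁ hin₁ hconf
    refine ⟨Φ, w, hmv, hcl.mono fun τ' hτ' => ?_⟩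
    obtain ⟨hadm', hcase⟩ := hτ'
    rcases hcase with hlt | ⟨hhead', hcol' | ⟨A', N', Θ', hpres', hWP', hfam⟩⟩
    · exact Or.inl ⟨hadm', Or.inl (hhead₁ ▸ hlt)⟩
    · exact Or.inl ⟨hadm', Or.inr ⟨hhead'.trans hhead₁, hcol'⟩⟩
    · refine hread τ' hadm' (hhead'.trans hhead₁) A' N' Θ' hpres' hWP' ?_
      by_cases hin' : InPoly d A'
      · exact Or.inl (hM_conf d A₁ N₁ A' N' hctx hin₁ hin' hconf hfam)
      · exact Or.inr (Or.inr hin')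
  · -- strategy move off the conflict: budget does not rise, polyhedron rank drops
    obtain ⟨Φ, w, hmv, hcl⟩ := hP2 b₁ δ₁ d A₁ N₁ Θ₁ hadm₁ ho₁' hc₁ hpres₁ hin₁ hconf
    refine ⟨Φ, w, hmv, hcl.mono fun τ' hτ' => ?_⟩
    obtain ⟨hadm', hcase⟩ := hτ'
    rcases hcase with hlt | ⟨hhead', hcol' | ⟨A', N', Θ', hpres', hWP', hfam⟩⟩
    · exact Or.inl ⟨hadm', Or.inl (hhead₁ ▸ hlt)⟩
    · exact Or.inl ⟨hadm', Or.inr ⟨hhead'.trans hhead₁, hcol'⟩⟩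
    · refine hread τ' hadm' (hhead'.trans hhead₁) A' N' Θ' hpres' hWP' ?_
      by_cases hin' : InPoly d A'
      · have hM := hM_succ d A₁ N₁ A' N' hctx hin₁ hin' hfam
        have hrel : PolyRelSel d (ψsel d) A' A₁ := ⟨mem_succTSel_of_succFamilySel hfam, hin₁, hin'⟩
        have hrk : rk A' < rk A₁ := ((wellFounded_polyRelSel (k := k) hd (hsel d)).apply A₁).rank_lt_of_rel hrel
        rcases hM.lt_or_eq with hMlt | hMeq
        · exact Or.inl hMlt
        · exact Or.inr (Or.inl ⟨hMeq, hrk⟩)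
      · exact Or.inr (Or.inr hin')

end TameFourTupleDrop

end Summit.ResolutionOfSingularities.ResolutionOfSingularities.Theorems

end
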